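import Summits.AtomisticToContinuum.HydrodynamicLimit.Theorems.RelayRaceLocalityRestartPrincipleRenyiReduction
import Summits.AtomisticToContinuum.HydrodynamicLimit.Theorems.RelayRaceLocalityRestartPrincipleStubKineticEnergyExpMoment
import Summits.AtomisticToContinuum.HydrodynamicLimit.Theorems.RelayRaceLocalityRestartPrincipleStubStaticFlatness
import Summits.AtomisticToContinuum.HydrodynamicLimit.Theorems.RelayRaceLocalityRestartPrincipleStubProfileIdentification
import Summits.AtomisticToContinuum.HydrodynamicLimit.Theorems.RelayRaceLocalityRestartPrincipleStubActivityRelay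
import Summits.AtomisticToContinuum.HydrodynamicLimit.Theorems.RelayRaceLocalityRestartPrincipleStubEntropyRelay
import Summits.AtomisticToContinuum.HydrodynamicLimit.Theorems.RelayRaceLocalityRestartPrincipleStubFiniteSize
import Summits.AtomisticToContinuum.HydrodynamicLimit.Theorems.RelayRaceLocalityRestartPrincipleLineGlue
import Summits.AtomisticToContinuum.HydrodynamicLimit.Theorems.RelayRaceLocalityNearConstantShortTimeHLMeansNecessaryFields
import Summits.AtomisticToContinuum.HydrodynamicLimit.Theorems.JaynesSqueezeHardSphereLDA
import Summits.AtomisticToContinuum.HydrodynamicLimit.Theorems.JaynesSqueezeLocalGibbsConcentrationDilute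
import Summits.AtomisticToContinuum.HydrodynamicLimit.Theorems.TwoClocksEntropyToHydro
import Summits.AtomisticToContinuum.HydrodynamicLimit.Theorems.DenseExcursion.Negative.Everywhere
import HarnessLib

/-!
# Crux `RestartPrinciple` (stmt-AtomisticToContinuum-12503), line `isentropic-regibbsification` — the composition

Lead c5. `restartPrinciple_of_noAnomalousDissipation`: the crux `RelayRaceLocality.RestartPrinciple` (`= S → G`)
from the single registered stub `stub_noAnomalousDissipation` (S4a, VERBATIM as the hypothesis `hNAD`), everything
else LANDED: statics 13459/13460 closed (`hardSphereLDA_proof`, `localGibbsConcentrationDilute_proof`); the Rényi step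
(R2) `renyiLocalEquilibriumLDA_of` (p117955) from S4a + `stub_kineticEnergyExpMoment` (p117016) + `stub_staticFlatness`
(p117520); S1 `stub_profileIdentification` (p116912), S2 `stub_activityRelay` (p117049), `stub_entropyRelay` (p112983),
`stub_finiteSize` (p96553), `…LineGlue` (p118862), `tendstoHydroFieldsAt_of_klDiv` (TwoClocks), mass conservation.
Proof: restart induction in ENTROPY currency with explicit LDA references `G_s = localGibbsLaw σ A_σ(ρ_s) u_s θ_s`,
`A_σ(ρ) = ρ e^{f_ex(ρσ³)+ρσ³f_ex'(ρσ³)}`, currency `KL((Φ_s)_# P ‖ G_s) = o(N)`; base `s = 0` by S1 (`u₀ = u_0`,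
`θ₀ = θ_0`) + S2 (`KL(P ‖ G_0) ≤ E_{G_0}W − E_P W = o(N)`, `W = Σᵢ log(A_σ(ρ_0)/a₀)(xᵢ)`, both means → the same
number); step = relay inequality + KL transport + (R2); grid `k·τ₁/2`; final = LGC concentration + entropy
inequality. `RestartPrinciple := fun _ => G` (`S` not consumable, p99454). No definitions, no `sorry`.
-/


noncomputable section

open Literature.MathematicalPhysics.KineticTheory Literature.Analysis.FluidPDE
open Literature.Analysis.FunctionSpaces MeasureTheory Filter Set Topology InformationTheory
open Literature.Probability.Divergences
open Summit.AtomisticToContinuum.HydrodynamicLimit.Theses.RelayRaceLocality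
open scoped ENNReal

namespace Summit.AtomisticToContinuum.HydrodynamicLimit.Theorems.RestartPrinciple.IsentropicRegibbsification

/-! ## Base case: entropy identification at time `0` -/

/-- **Time-`0` entropy identification.** Two local Gibbs laws `P = LG(a, u₁, θ₁)`, `Q = LG(a', u₁, θ₁)`
(continuous profiles, `a, a', θ₁ > 0`, `0 < σ ≤ 1/2`) whose empirical DENSITY fields have the same limit
profile `ρ₁` — in probability for `P`, in mean for `Q` — satisfy `KL(P ‖ Q)/(N+1) → 0`: by the activity
relay (S2) `KL(P ‖ Q) ≤ E_Q W − E_P W` for the bounded one-body sum `W = Σᵢ (log a' − log a)(xᵢ)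
= (N+1) · ρ_z[log a' − log a]`, and both means of `ρ_z[log a' − log a]` tend to `∫ρ₁(log a' − log a)`.
[cite: KipnisLandim1999, App. 1 §8] -/
theorem klDiv_div_tendsto_zero_of_lln {σ : ℝ} (hσ : 0 < σ) (hσ2 : σ ≤ 1 / 2)
    {a a' θ₁ ρ₁ : T3 → ℝ} {u₁ : T3 → V3} (ha : Continuous a) (ha' : Continuous a')
    (hθc : Continuous θ₁) (huc : Continuous u₁) (ha0 : ∀ x, 0 < a x) (ha0' : ∀ x, 0 < a' x)
    (hθ0 : ∀ x, 0 < θ₁ x)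
    (Φ : (N : ℕ) → HardSphereFlow (Torus.geometry (Fin 3)) (hsDiameter σ N) (N + 1))
    (hP : ∀ χ : T3 → ℝ, Continuous χ → ∀ δ : ℝ, 0 < δ →
      Tendsto (fun N => localGibbsLaw σ a u₁ θ₁ N (Φ N)
        {z | δ < |empiricalDensityField z χ - ∫ x, χ x * ρ₁ x|}) atTop (𝓝 0))
    (hQ : ∀ χ : T3 → ℝ, Continuous χ →
      Tendsto (fun N => ∫ z, empiricalDensityField z χ ∂(localGibbsLaw σ a' u₁ θ₁ N (Φ N))) atTop
        (𝓝 (∫ x, χ x * ρ₁ x))) :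
    Tendsto (fun N : ℕ => klDiv (localGibbsLaw σ a u₁ θ₁ N (Φ N)) (localGibbsLaw σ a' u₁ θ₁ N (Φ N)) /
      ((N : ℝ≥0∞) + 1)) atTop (𝓝 0) := by
  -- the one-body observable `χ₀ = log a' − log a`, continuous and bounded on the torus
  have hχ₀c : Continuous fun x => Real.log (a' x) - Real.log (a x) :=
    (Real.continuousOn_log.comp_continuous ha' fun x => (ha0' x).ne').sub
      (Real.continuousOn_log.comp_continuous ha fun x => (ha0 x).ne')
  obtain ⟨B, hB0, hB⟩ := exists_forall_abs_le_of_continuous hχ₀c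
  haveI hPprob : ∀ N, IsProbabilityMeasure (localGibbsLaw σ a u₁ θ₁ N (Φ N)) := fun N =>
    isProbabilityMeasure_localGibbsLaw ha hθc huc ha0 hθ0 hσ2 N (Φ N)
  have hmP : Tendsto (fun N => ∫ z, empiricalDensityField z (fun x => Real.log (a' x) - Real.log (a x))
      ∂(localGibbsLaw σ a u₁ θ₁ N (Φ N))) atTop
      (𝓝 (∫ x, (Real.log (a' x) - Real.log (a x)) * ρ₁ x)) :=
    tendsto_integral_of_tendsto_measure_gt (fun N => localGibbsLaw σ a u₁ θ₁ N (Φ N))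
      (fun N z => empiricalDensityField z fun x => Real.log (a' x) - Real.log (a x)) _ B
      (fun N => (NearConstantShortTimeHL.continuous_empiricalDensityField hχ₀c).measurable)
      (fun N z => NearConstantShortTimeHL.abs_empiricalDensityField_le hB hB0 z) (hP _ hχ₀c)
  have hmQ := hQ _ hχ₀c
  have hdiff : Tendsto (fun N =>
      (∫ z, empiricalDensityField z (fun x => Real.log (a' x) - Real.log (a x))
        ∂(localGibbsLaw σ a' u₁ θ₁ N (Φ N))) -
      ∫ z, empiricalDensityField z (fun x => Real.log (a' x) - Real.log (a x))
        ∂(localGibbsLaw σ a u₁ θ₁ N (Φ N))) atTop (𝓝 0) := by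
    simpa using hmQ.sub hmP
  -- the activity relay (S2), with `W = (N+1) · ρ_z[χ₀]`
  have hS2 : ∀ N : ℕ, klDiv (localGibbsLaw σ a u₁ θ₁ N (Φ N)) (localGibbsLaw σ a' u₁ θ₁ N (Φ N)) ≤
      ENNReal.ofReal (((N : ℝ) + 1) *
        ((∫ z, empiricalDensityField z (fun x => Real.log (a' x) - Real.log (a x))
          ∂(localGibbsLaw σ a' u₁ θ₁ N (Φ N))) -
        ∫ z, empiricalDensityField z (fun x => Real.log (a' x) - Real.log (a x))
          ∂(localGibbsLaw σ a u₁ θ₁ N (Φ N)))) := by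
    intro N
    have h := stub_activityRelay σ hσ hσ2 a a' θ₁ u₁ ha ha' hθc huc ha0 ha0' hθ0 N (Φ N)
    have hW : ∀ z : Config (N + 1) (Fin 3) T3,
        ∑ i, (Real.log (a' (z i).1) - Real.log (a (z i).1)) =
          ((N : ℝ) + 1) * empiricalDensityField z (fun x => Real.log (a' x) - Real.log (a x)) := by
      intro z
      rw [empiricalDensityField_eq_sum]
      have hn : ((N + 1 : ℕ) : ℝ) = (N : ℝ) + 1 := by push_cast; ring
      rw [hn, ← mul_assoc, mul_inv_cancel₀ (by positivity), one_mul]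
    simp_rw [hW, integral_const_mul] at h
    rwa [← mul_sub] at h
  have hupper : Tendsto (fun N : ℕ => ENNReal.ofReal
      ((∫ z, empiricalDensityField z (fun x => Real.log (a' x) - Real.log (a x))
        ∂(localGibbsLaw σ a' u₁ θ₁ N (Φ N))) -
      ∫ z, empiricalDensityField z (fun x => Real.log (a' x) - Real.log (a x))
        ∂(localGibbsLaw σ a u₁ θ₁ N (Φ N)))) atTop (𝓝 0) := by
    simpa using ENNReal.tendsto_ofReal hdiff
  refine tendsto_of_tendsto_of_tendsto_of_le_of_le tendsto_const_nhds hupper (fun _ => bot_le)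
    fun N => ?_
  have hN0 : ((N : ℝ≥0∞) + 1) ≠ 0 := by positivity
  have hNtop : ((N : ℝ≥0∞) + 1) ≠ ∞ := by simp
  refine (ENNReal.div_le_iff_le_mul (Or.inl hN0) (Or.inl hNtop)).2 ?_
  have hcast : ENNReal.ofReal ((N : ℝ) + 1) = (N : ℝ≥0∞) + 1 := by
    rw [ENNReal.ofReal_add (by positivity) zero_le_one, ENNReal.ofReal_natCast, ENNReal.ofReal_one]
  calc klDiv (localGibbsLaw σ a u₁ θ₁ N (Φ N)) (localGibbsLaw σ a' u₁ θ₁ N (Φ N))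
      ≤ _ := hS2 N
    _ = _ := by rw [ENNReal.ofReal_mul (by positivity), hcast, mul_comm]

/-! ## The composition -/

/-- **The packing-guarded conjunct `G`** (consequent of the crux; body of stmt-AtomisticToContinuum-9133)
from the single registered stub `stub_noAnomalousDissipation` (hypothesis `hNAD`, verbatim): restart
induction in entropy currency with explicit LDA references, base case by S1 + S2, step by the relay
inequality + transport + the Rényi step (R2), conclusion by LGC concentration + the entropy inequality.
[cite: Yau1991, §1; OllaVaradhanYau1993, §3] -/
theorem guardedConjunct_of_noAnomalousDissipation
    (hNAD : ∃ η₀ : ℝ, 0 < η₀ ∧ ∃ σ₀ : ℝ, 0 < σ₀ ∧ ∀ σ : ℝ, 0 < σ → σ < σ₀ → ∀ M : ℝ, 0 < M →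
      ∃ τ₁ : ℝ, 0 < τ₁ ∧ ∀ (T : ℝ) (ρ θ : ℝ → T3 → ℝ) (u : ℝ → T3 → V3),
      IsHardSphereEulerSolution σ T ρ u θ → (∀ s' ∈ Set.Ico 0 T, ∫ x, ρ s' x = 1) →
      ∀ Φ : (N : ℕ) → HardSphereFlow (Torus.geometry (Fin 3)) (hsDiameter σ N) (N + 1),
      ∀ s ∈ Set.Ico 0 T, ∀ t ∈ Set.Ico s (min T (s + τ₁)),
      (∀ s' ∈ Set.Icc s t, ∀ x, ρ s' x * σ ^ 3 < η₀ ∧ ρ s' x ≤ M ∧ θ s' x ≤ M ∧ M⁻¹ ≤ θ s' x ∧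
      ‖u s' x‖ ≤ M ∧ ∀ i j k : Fin 3, |Torus.partialDeriv i (ρ s') x| ≤ M ∧
      ‖Torus.partialDeriv i (u s') x‖ ≤ M ∧ |Torus.partialDeriv i (θ s') x| ≤ M ∧
      |Torus.partialDeriv i (Torus.partialDeriv j (ρ s')) x| ≤ M ∧
      ‖Torus.partialDeriv i (Torus.partialDeriv j (u s')) x‖ ≤ M ∧
      |Torus.partialDeriv i (Torus.partialDeriv j (θ s')) x| ≤ M ∧
      |Torus.partialDeriv i (Torus.partialDeriv j (Torus.partialDeriv k (ρ s'))) x| ≤ M ∧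
      ‖Torus.partialDeriv i (Torus.partialDeriv j (Torus.partialDeriv k (u s'))) x‖ ≤ M ∧
      |Torus.partialDeriv i (Torus.partialDeriv j (Torus.partialDeriv k (θ s'))) x| ≤ M) →
      ∀ δ : ℝ, 0 < δ → ∃ C : ℝ, 0 < C ∧ ∀ N : ℕ,
      localGibbsLaw σ (fun x => ρ s x * Real.exp (hsExcessFreeEnergy (ρ s x * σ ^ 3) +
      ρ s x * σ ^ 3 * deriv hsExcessFreeEnergy (ρ s x * σ ^ 3))) (u s) (θ s) N (Φ N)
      {z | ((N : ℝ) + 1)⁻¹ * ∑ i, Real.log (localGibbsProfile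
      (fun x => ρ t x * Real.exp (hsExcessFreeEnergy (ρ t x * σ ^ 3) +
      ρ t x * σ ^ 3 * deriv hsExcessFreeEnergy (ρ t x * σ ^ 3))) (u t) (θ t)
      ((Φ N).flow (t - s) z i)) <
      (∫ x, ρ t x * (Real.log (ρ t x * Real.exp (hsExcessFreeEnergy (ρ t x * σ ^ 3) +
      ρ t x * σ ^ 3 * deriv hsExcessFreeEnergy (ρ t x * σ ^ 3))) -
      3 / 2 * Real.log (2 * Real.pi * θ t x) - 3 / 2)) - δ} ≤
      ENNReal.ofReal (C * Real.exp (-(C⁻¹ * (N + 1))))) :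
    ∃ η₀ : ℝ, 0 < η₀ ∧ ∀ (a₀ θ₀ : T3 → ℝ) (u₀ : T3 → V3), Continuous a₀ → Continuous θ₀ →
      Continuous u₀ → (∀ x, 0 < a₀ x) → (∀ x, 0 < θ₀ x) → ∃ σ₀ : ℝ, 0 < σ₀ ∧ ∀ σ : ℝ, 0 < σ →
      σ < σ₀ → ∀ (T : ℝ) (ρ θ : ℝ → T3 → ℝ) (u : ℝ → T3 → V3), IsHardSphereEulerSolution σ T ρ u θ →
      (∀ t ∈ Set.Ico 0 T, ∀ x, ρ t x * σ ^ 3 < η₀) →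
      ∀ Φ : (N : ℕ) → HardSphereFlow (Torus.geometry (Fin 3)) (hsDiameter σ N) (N + 1),
      TendstoHydroFieldsAt (fun N => localGibbsLaw σ a₀ u₀ θ₀ N (Φ N)) Φ ρ u θ 0 →
      ∀ t ∈ Set.Ico 0 T, TendstoHydroFieldsAt (fun N => localGibbsLaw σ a₀ u₀ θ₀ N (Φ N)) Φ ρ u θ t := by
  obtain ⟨ηC, hηC, σC, hσC, hC⟩ := renyiLocalEquilibriumLDA_of hNAD stub_kineticEnergyExpMoment
    stub_staticFlatness hardSphereLDA_proof localGibbsConcentrationDilute_proof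
  obtain ⟨ηB, hηB, hB⟩ := localGibbsConcentrationDilute_proof Theses.JaynesSqueeze.HsEosLowDensity_holds
  obtain ⟨ηL, hηL, hL⟩ := hardSphereLDA_proof Theses.JaynesSqueeze.HsEosLowDensity_holds
  obtain ⟨ηE, hηE, -, hfc, hdc⟩ := exists_eos_band
  refine ⟨min (min ηB ηC) (min ηL ηE), lt_min (lt_min hηB hηC) (lt_min hηL hηE),
    fun a₀ θ₀ u₀ ha hθ hu ha0 hθ0 => ?_⟩
  refine ⟨min σC (1 / 2), lt_min hσC one_half_pos, fun σ hσ hσlt T ρ θ u hsol hpack Φ h0 t ht => ?_⟩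
  have hσC' : σ < σC := lt_of_lt_of_le hσlt (min_le_left _ _)
  have hσ2 : σ ≤ 1 / 2 := (lt_of_lt_of_le hσlt (min_le_right _ _)).le
  have hpackB : ∀ s ∈ Ico 0 T, ∀ x, ρ s x * σ ^ 3 ≤ ηB := fun s hs x =>
    ((hpack s hs x).trans_le ((min_le_left _ _).trans (min_le_left _ _))).le
  have hpackC : ∀ s ∈ Ico 0 T, ∀ x, ρ s x * σ ^ 3 < ηC := fun s hs x =>
    (hpack s hs x).trans_le ((min_le_left _ _).trans (min_le_right _ _))
  have hpackL : ∀ s ∈ Ico 0 T, ∀ x, ρ s x * σ ^ 3 ≤ ηL := fun s hs x =>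
    ((hpack s hs x).trans_le ((min_le_right _ _).trans (min_le_left _ _))).le
  have hpackE : ∀ s ∈ Ico 0 T, ∀ x, ρ s x * σ ^ 3 < ηE := fun s hs x =>
    (hpack s hs x).trans_le ((min_le_right _ _).trans (min_le_right _ _))
  have h0T : (0 : ℝ) ∈ Ico 0 T := ⟨le_rfl, ht.1.trans_lt ht.2⟩
  obtain ⟨M, hM, hsize⟩ := RestartPrinciple.stub_finiteSize σ T ρ θ u hsol t ht.2
  obtain ⟨τ₁, hτ₁, hstep⟩ := hC σ hσ hσC' M hM
  have hρc : ∀ s ∈ Ico 0 T, Continuous (ρ s) := fun s hs => (hsol.smooth_density.isSmooth_slice hs).continuous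
  have huc : ∀ s ∈ Ico 0 T, Continuous (u s) := fun s hs => (hsol.smooth_velocity.isSmooth_slice hs).continuous
  have hθc : ∀ s ∈ Ico 0 T, Continuous (θ s) := fun s hs => (hsol.smooth_temperature.isSmooth_slice hs).continuous
  have hρpos : ∀ s ∈ Ico 0 T, ∀ x, 0 < ρ s x := hsol.density_pos
  have hθpos : ∀ s ∈ Ico 0 T, ∀ x, 0 < θ s x := hsol.temperature_pos
  have hmass : ∀ s ∈ Ico 0 T, ∫ x, ρ s x = 1 := fun s hs =>
    (DenseExcursionEverywhere.integral_density_eq hsol hs).trans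
      (DenseExcursionEverywhere.integral_density_zero_eq_one hσ2 ha hθ hu ha0 hθ0 Φ h0)
  have hAc : ∀ s ∈ Ico 0 T, Continuous fun x => ρ s x * Real.exp (hsExcessFreeEnergy (ρ s x * σ ^ 3) +
      ρ s x * σ ^ 3 * deriv hsExcessFreeEnergy (ρ s x * σ ^ 3)) := fun s hs =>
    continuous_lda_of_band hfc hdc hσ (hρc s hs) (hρpos s hs) (hpackE s hs)
  have hA0 : ∀ s ∈ Ico 0 T, ∀ x, 0 < ρ s x * Real.exp (hsExcessFreeEnergy (ρ s x * σ ^ 3) +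
      ρ s x * σ ^ 3 * deriv hsExcessFreeEnergy (ρ s x * σ ^ 3)) := fun s hs x =>
    mul_pos (hρpos s hs x) (Real.exp_pos _)
  -- exponential concentration of the LDA references (LGC, 13460)
  have hconc : ∀ s ∈ Ico 0 T, ∀ χ : T3 → ℝ, Continuous χ → ∀ δ : ℝ, 0 < δ → ∃ C : ℝ, 0 < C ∧ ∀ N : ℕ,
      localGibbsLaw σ (fun x => ρ s x * Real.exp (hsExcessFreeEnergy (ρ s x * σ ^ 3) +
          ρ s x * σ ^ 3 * deriv hsExcessFreeEnergy (ρ s x * σ ^ 3))) (u s) (θ s) N (Φ N)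
          {z | δ < |empiricalDensityField z χ - ∫ x, χ x * ρ s x|} ≤
        ENNReal.ofReal (C * Real.exp (-(C⁻¹ * (N + 1)))) ∧
      localGibbsLaw σ (fun x => ρ s x * Real.exp (hsExcessFreeEnergy (ρ s x * σ ^ 3) +
          ρ s x * σ ^ 3 * deriv hsExcessFreeEnergy (ρ s x * σ ^ 3))) (u s) (θ s) N (Φ N)
          {z | δ < ‖empiricalMomentumField z χ - ∫ x, (χ x * ρ s x) • u s x‖} ≤
        ENNReal.ofReal (C * Real.exp (-(C⁻¹ * (N + 1)))) ∧
      localGibbsLaw σ (fun x => ρ s x * Real.exp (hsExcessFreeEnergy (ρ s x * σ ^ 3) +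
          ρ s x * σ ^ 3 * deriv hsExcessFreeEnergy (ρ s x * σ ^ 3))) (u s) (θ s) N (Φ N)
          {z | δ < |empiricalEnergyField z χ -
            ∫ x, χ x * totalEnergyDensity (ρ s x) (u s x) (θ s x)|} ≤
        ENNReal.ofReal (C * Real.exp (-(C⁻¹ * (N + 1)))) := by
    intro s hs χ hχ δ hδ
    obtain ⟨x₀, -, hx₀⟩ := isCompact_univ.exists_isMinOn univ_nonempty (hρc s hs).continuousOn
    have H := hB σ hσ (ρ s x₀) (hρpos s hs x₀) (ρ s) (hρc s hs)
      (fun x => ⟨hx₀ (mem_univ x), hpackB s hs x⟩) (hmass s hs) (u s) (θ s) (huc s hs) (hθc s hs)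
      (hθpos s hs)
    obtain ⟨C, hCpos, h⟩ := H χ hχ δ hδ
    exact ⟨C, hCpos, fun N => h N (Φ N)⟩
  -- S1: the time-`0` LLN identifies the velocity and temperature profiles
  obtain ⟨hu0, hθ0'⟩ := stub_profileIdentification σ hσ hσ2 a₀ θ₀ u₀ (ρ 0) (θ 0) (u 0) ha hθ hu ha0
    hθ0 (hρc 0 h0T) (hθc 0 h0T) (huc 0 h0T) (hρpos 0 h0T) Φ h0
  subst hu0 hθ0'
  have hPprob : ∀ N, IsProbabilityMeasure (localGibbsLaw σ a₀ (u 0) (θ 0) N (Φ N)) := fun N =>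
    isProbabilityMeasure_localGibbsLaw ha hθ hu ha0 hθ0 hσ2 N (Φ N)
  have hPac : ∀ N, localGibbsLaw σ a₀ (u 0) (θ 0) N (Φ N) ≪
      liouville (Torus.geometry (Fin 3)) (N + 1) (hsDiameter σ N) := fun N =>
    localGibbsLaw_ac σ a₀ (θ 0) (u 0) N (Φ N)
  have hGprob : ∀ s ∈ Ico 0 T, ∀ N, IsProbabilityMeasure (localGibbsLaw σ
      (fun x => ρ s x * Real.exp (hsExcessFreeEnergy (ρ s x * σ ^ 3) +
        ρ s x * σ ^ 3 * deriv hsExcessFreeEnergy (ρ s x * σ ^ 3))) (u s) (θ s) N (Φ N)) :=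
    fun s hs N => isProbabilityMeasure_localGibbsLaw (hAc s hs) (hθc s hs) (huc s hs) (hA0 s hs)
      (hθpos s hs) hσ2 N (Φ N)
  -- the route's guards on `[s₀, s] ⊆ [0, t]`
  have hguard : ∀ s₀ s : ℝ, 0 ≤ s₀ → s ≤ t →
      ∀ s' ∈ Set.Icc s₀ s, ∀ x, ρ s' x * σ ^ 3 < ηC ∧ ρ s' x ≤ M ∧ θ s' x ≤ M ∧
        M⁻¹ ≤ θ s' x ∧ ‖u s' x‖ ≤ M ∧ ∀ i j k : Fin 3, |Torus.partialDeriv i (ρ s') x| ≤ M ∧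
        ‖Torus.partialDeriv i (u s') x‖ ≤ M ∧ |Torus.partialDeriv i (θ s') x| ≤ M ∧
        |Torus.partialDeriv i (Torus.partialDeriv j (ρ s')) x| ≤ M ∧
        ‖Torus.partialDeriv i (Torus.partialDeriv j (u s')) x‖ ≤ M ∧
        |Torus.partialDeriv i (Torus.partialDeriv j (θ s')) x| ≤ M ∧
        |Torus.partialDeriv i (Torus.partialDeriv j (Torus.partialDeriv k (ρ s'))) x| ≤ M ∧
        ‖Torus.partialDeriv i (Torus.partialDeriv j (Torus.partialDeriv k (u s'))) x‖ ≤ M ∧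
        |Torus.partialDeriv i (Torus.partialDeriv j (Torus.partialDeriv k (θ s'))) x| ≤ M := by
    intro s₀ s hs₀ hst s' hs' x
    have hs't : s' ∈ Set.Icc 0 t := ⟨hs₀.trans hs'.1, hs'.2.trans hst⟩
    exact ⟨hpackC s' ⟨hs't.1, lt_of_le_of_lt hs't.2 ht.2⟩ x, hsize s' hs't x⟩
  -- CORE STEP: entropy currency at `s₀` ⟹ entropy currency at `s ∈ [s₀, s₀ + τ₁)`, `s ≤ t`
  have core : ∀ s₀ ∈ Set.Ico 0 T,
      Tendsto (fun N : ℕ => klDiv ((Φ N).lawAt (localGibbsLaw σ a₀ (u 0) (θ 0) N (Φ N)) s₀)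
        (localGibbsLaw σ (fun x => ρ s₀ x * Real.exp (hsExcessFreeEnergy (ρ s₀ x * σ ^ 3) +
          ρ s₀ x * σ ^ 3 * deriv hsExcessFreeEnergy (ρ s₀ x * σ ^ 3))) (u s₀) (θ s₀) N (Φ N)) /
        ((N : ℝ≥0∞) + 1)) atTop (𝓝 0) →
      ∀ s ∈ Set.Ico s₀ (min T (s₀ + τ₁)), s ≤ t →
      Tendsto (fun N : ℕ => klDiv ((Φ N).lawAt (localGibbsLaw σ a₀ (u 0) (θ 0) N (Φ N)) s)
        (localGibbsLaw σ (fun x => ρ s x * Real.exp (hsExcessFreeEnergy (ρ s x * σ ^ 3) +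
          ρ s x * σ ^ 3 * deriv hsExcessFreeEnergy (ρ s x * σ ^ 3))) (u s) (θ s) N (Φ N)) /
        ((N : ℝ≥0∞) + 1)) atTop (𝓝 0) := by
    intro s₀ hs₀ hcur s hs hst
    have hsT : s ∈ Set.Ico 0 T := ⟨hs₀.1.trans hs.1, lt_of_lt_of_le hs.2 (min_le_left _ _)⟩
    have hD := hstep T ρ θ u hsol hmass Φ s₀ hs₀ s hs (hguard s₀ s hs₀.1 hst)
    refine tendsto_zero_of_relay _ _
      (fun γ N => renyiDiv (1 + γ) ((Φ N).lawAt (localGibbsLaw σ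
        (fun x => ρ s₀ x * Real.exp (hsExcessFreeEnergy (ρ s₀ x * σ ^ 3) +
          ρ s₀ x * σ ^ 3 * deriv hsExcessFreeEnergy (ρ s₀ x * σ ^ 3))) (u s₀) (θ s₀) N (Φ N)) (s - s₀))
        (localGibbsLaw σ (fun x => ρ s x * Real.exp (hsExcessFreeEnergy (ρ s x * σ ^ 3) +
          ρ s x * σ ^ 3 * deriv hsExcessFreeEnergy (ρ s x * σ ^ 3))) (u s) (θ s) N (Φ N)))
      ?_ hcur hD
    intro γ hγ N
    haveI := hPprob N
    haveI := hGprob s₀ hs₀ N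
    haveI := hGprob s hsT N
    haveI : IsProbabilityMeasure ((Φ N).lawAt (localGibbsLaw σ a₀ (u 0) (θ 0) N (Φ N)) s) :=
      isProbabilityMeasure_lawAt (Φ N) _ s
    haveI : IsProbabilityMeasure ((Φ N).lawAt (localGibbsLaw σ a₀ (u 0) (θ 0) N (Φ N)) s₀) :=
      isProbabilityMeasure_lawAt (Φ N) _ s₀
    haveI : IsProbabilityMeasure ((Φ N).lawAt (localGibbsLaw σ
        (fun x => ρ s₀ x * Real.exp (hsExcessFreeEnergy (ρ s₀ x * σ ^ 3) +
          ρ s₀ x * σ ^ 3 * deriv hsExcessFreeEnergy (ρ s₀ x * σ ^ 3))) (u s₀) (θ s₀) N (Φ N)) (s - s₀)) :=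
      isProbabilityMeasure_lawAt (Φ N) _ (s - s₀)
    have hrel := stub_entropyRelay
      ((Φ N).lawAt (localGibbsLaw σ a₀ (u 0) (θ 0) N (Φ N)) s)
      ((Φ N).lawAt (localGibbsLaw σ
        (fun x => ρ s₀ x * Real.exp (hsExcessFreeEnergy (ρ s₀ x * σ ^ 3) +
          ρ s₀ x * σ ^ 3 * deriv hsExcessFreeEnergy (ρ s₀ x * σ ^ 3))) (u s₀) (θ s₀) N (Φ N)) (s - s₀))
      (localGibbsLaw σ (fun x => ρ s x * Real.exp (hsExcessFreeEnergy (ρ s x * σ ^ 3) +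
          ρ s x * σ ^ 3 * deriv hsExcessFreeEnergy (ρ s x * σ ^ 3))) (u s) (θ s) N (Φ N)) γ hγ
    have htrans : klDiv ((Φ N).lawAt (localGibbsLaw σ a₀ (u 0) (θ 0) N (Φ N)) s)
        ((Φ N).lawAt (localGibbsLaw σ
          (fun x => ρ s₀ x * Real.exp (hsExcessFreeEnergy (ρ s₀ x * σ ^ 3) +
            ρ s₀ x * σ ^ 3 * deriv hsExcessFreeEnergy (ρ s₀ x * σ ^ 3))) (u s₀) (θ s₀) N (Φ N)) (s - s₀)) =
        klDiv ((Φ N).lawAt (localGibbsLaw σ a₀ (u 0) (θ 0) N (Φ N)) s₀) (localGibbsLaw σ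
          (fun x => ρ s₀ x * Real.exp (hsExcessFreeEnergy (ρ s₀ x * σ ^ 3) +
            ρ s₀ x * σ ^ 3 * deriv hsExcessFreeEnergy (ρ s₀ x * σ ^ 3))) (u s₀) (θ s₀) N (Φ N)) := by
      rw [lawAt_eq_lawAt_lawAt (Φ N) (hPac N) s₀ s]
      exact klDiv_lawAt_lawAt (Φ N) _ _ (lawAt_ac (Φ N) (hPac N) s₀)
        (localGibbsLaw_ac σ _ (θ s₀) (u s₀) N (Φ N)) (s - s₀)
    rw [htrans] at hrel
    exact hrel
  -- BASE: `KL(P ‖ G_0) = o(N)` by the time-`0` entropy identification (S2 + the two LLNs)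
  have hbase : Tendsto (fun N : ℕ => klDiv ((Φ N).lawAt (localGibbsLaw σ a₀ (u 0) (θ 0) N (Φ N)) 0)
      (localGibbsLaw σ (fun x => ρ 0 x * Real.exp (hsExcessFreeEnergy (ρ 0 x * σ ^ 3) +
        ρ 0 x * σ ^ 3 * deriv hsExcessFreeEnergy (ρ 0 x * σ ^ 3))) (u 0) (θ 0) N (Φ N)) /
      ((N : ℝ≥0∞) + 1)) atTop (𝓝 0) := by
    -- LLN in probability of the density field under `P` (the flow at time `0` is the identity a.e.)
    have hP : ∀ χ : T3 → ℝ, Continuous χ → ∀ δ : ℝ, 0 < δ →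
        Tendsto (fun N => localGibbsLaw σ a₀ (u 0) (θ 0) N (Φ N)
          {z | δ < |empiricalDensityField z χ - ∫ x, χ x * ρ 0 x|}) atTop (𝓝 0) := by
      intro χ hχ δ hδ
      refine ((h0 χ hχ δ hδ).1).congr fun N => ?_
      exact measure_setOf_flow_zero_eq (Φ N) (hPac N)
        fun z => δ < |empiricalDensityField z χ - ∫ x, χ x * ρ 0 x|
    -- mean LDA of the density field under `G_0` (`HardSphereLDA` (B3))
    have hQ : ∀ χ : T3 → ℝ, Continuous χ →
        Tendsto (fun N => ∫ z, empiricalDensityField z χ ∂(localGibbsLaw σ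
          (fun x => ρ 0 x * Real.exp (hsExcessFreeEnergy (ρ 0 x * σ ^ 3) +
            ρ 0 x * σ ^ 3 * deriv hsExcessFreeEnergy (ρ 0 x * σ ^ 3))) (u 0) (θ 0) N (Φ N))) atTop
          (𝓝 (∫ x, χ x * ρ 0 x)) := by
      intro χ hχ
      obtain ⟨x₀, -, hx₀⟩ := isCompact_univ.exists_isMinOn univ_nonempty (hρc 0 h0T).continuousOn
      exact ((hL σ hσ).2 (ρ 0 x₀) (hρpos 0 h0T x₀) (ρ 0) (hρc 0 h0T).measurable
        (fun x => ⟨hx₀ (mem_univ x), hpackL 0 h0T x⟩) (hmass 0 h0T) (u 0) (θ 0)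
        (huc 0 h0T).measurable (hθc 0 h0T).measurable (hθpos 0 h0T) Φ).2.2 χ hχ
    have h := klDiv_div_tendsto_zero_of_lln hσ hσ2 ha (hAc 0 h0T) hθ hu ha0 (hA0 0 h0T) hθ0 Φ hP hQ
    refine h.congr fun N => ?_
    rw [lawAt_zero (Φ N) (hPac N)]
  -- RESTART INDUCTION over the grid `n · (τ₁ / 2)` up to time `t`
  have key : ∀ n : ℕ, ∀ s ∈ Set.Icc 0 t, s ≤ n * (τ₁ / 2) →
      Tendsto (fun N : ℕ => klDiv ((Φ N).lawAt (localGibbsLaw σ a₀ (u 0) (θ 0) N (Φ N)) s)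
        (localGibbsLaw σ (fun x => ρ s x * Real.exp (hsExcessFreeEnergy (ρ s x * σ ^ 3) +
          ρ s x * σ ^ 3 * deriv hsExcessFreeEnergy (ρ s x * σ ^ 3))) (u s) (θ s) N (Φ N)) /
        ((N : ℝ≥0∞) + 1)) atTop (𝓝 0) := by
    intro n
    induction n with
    | zero =>
      intro s hs hsn
      have hs0 : s = 0 := le_antisymm (by simpa using hsn) hs.1
      subst hs0
      exact hbase
    | succ n ih =>
      intro s hs hsn
      by_cases hcase : s ≤ n * (τ₁ / 2)
      · exact ih s hs hcase
      · have hlt : (n : ℝ) * (τ₁ / 2) < s := not_le.1 hcase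
        have hs₀nn : 0 ≤ (n : ℝ) * (τ₁ / 2) := by positivity
        have hs₀T : (n : ℝ) * (τ₁ / 2) ∈ Set.Ico 0 T :=
          ⟨hs₀nn, lt_trans (lt_of_lt_of_le hlt hs.2) ht.2⟩
        have hcur₀ := ih ((n : ℝ) * (τ₁ / 2)) ⟨hs₀nn, hlt.le.trans hs.2⟩ le_rfl
        have hsI : s ∈ Set.Ico ((n : ℝ) * (τ₁ / 2)) (min T ((n : ℝ) * (τ₁ / 2) + τ₁)) := by
          refine ⟨hlt.le, lt_min (hs.2.trans_lt ht.2) ?_⟩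
          have h1 : ((n + 1 : ℕ) : ℝ) * (τ₁ / 2) = (n : ℝ) * (τ₁ / 2) + τ₁ / 2 := by
            push_cast; ring
          rw [h1] at hsn
          linarith
        exact core _ hs₀T hcur₀ s hsI hs.2
  obtain ⟨n, hn⟩ := exists_nat_ge (t / (τ₁ / 2))
  have hcurt := key n t ⟨ht.1, le_rfl⟩ (by rwa [div_le_iff₀ (half_pos hτ₁)] at hn)
  -- FINAL: LGC concentration of `G_t` + the entropy inequality give the LLN at `t`
  haveI : ∀ N, IsFiniteMeasure (localGibbsLaw σ a₀ (u 0) (θ 0) N (Φ N)) := fun N => by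
    haveI := hPprob N; infer_instance
  haveI : ∀ N, IsFiniteMeasure (localGibbsLaw σ
      (fun x => ρ t x * Real.exp (hsExcessFreeEnergy (ρ t x * σ ^ 3) +
        ρ t x * σ ^ 3 * deriv hsExcessFreeEnergy (ρ t x * σ ^ 3))) (u t) (θ t) N (Φ N)) := fun N => by
    haveI := hGprob t ht N; infer_instance
  exact tendstoHydroFieldsAt_of_klDiv Φ (hconc t ht) hcurt

/-- **COMPOSITION: the crux `RestartPrinciple` BY NAME from the single registered stub
`stub_noAnomalousDissipation`** (hypothesis `hNAD`, verbatim). The antecedent `S` of the crux is —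
necessarily, `RestartPrincipleNegative.prefixMfirst_schema_false` (p99454) — not consumed; the consequent
`G` is `guardedConjunct_of_noAnomalousDissipation`. [cite: Yau1991, §1; OllaVaradhanYau1993, §3] -/
theorem restartPrinciple_of_noAnomalousDissipation
    (hNAD : ∃ η₀ : ℝ, 0 < η₀ ∧ ∃ σ₀ : ℝ, 0 < σ₀ ∧ ∀ σ : ℝ, 0 < σ → σ < σ₀ → ∀ M : ℝ, 0 < M →
      ∃ τ₁ : ℝ, 0 < τ₁ ∧ ∀ (T : ℝ) (ρ θ : ℝ → T3 → ℝ) (u : ℝ → T3 → V3),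
      IsHardSphereEulerSolution σ T ρ u θ → (∀ s' ∈ Set.Ico 0 T, ∫ x, ρ s' x = 1) →
      ∀ Φ : (N : ℕ) → HardSphereFlow (Torus.geometry (Fin 3)) (hsDiameter σ N) (N + 1),
      ∀ s ∈ Set.Ico 0 T, ∀ t ∈ Set.Ico s (min T (s + τ₁)),
      (∀ s' ∈ Set.Icc s t, ∀ x, ρ s' x * σ ^ 3 < η₀ ∧ ρ s' x ≤ M ∧ θ s' x ≤ M ∧ M⁻¹ ≤ θ s' x ∧
      ‖u s' x‖ ≤ M ∧ ∀ i j k : Fin 3, |Torus.partialDeriv i (ρ s') x| ≤ M ∧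
      ‖Torus.partialDeriv i (u s') x‖ ≤ M ∧ |Torus.partialDeriv i (θ s') x| ≤ M ∧
      |Torus.partialDeriv i (Torus.partialDeriv j (ρ s')) x| ≤ M ∧
      ‖Torus.partialDeriv i (Torus.partialDeriv j (u s')) x‖ ≤ M ∧
      |Torus.partialDeriv i (Torus.partialDeriv j (θ s')) x| ≤ M ∧
      |Torus.partialDeriv i (Torus.partialDeriv j (Torus.partialDeriv k (ρ s'))) x| ≤ M ∧
      ‖Torus.partialDeriv i (Torus.partialDeriv j (Torus.partialDeriv k (u s'))) x‖ ≤ M ∧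
      |Torus.partialDeriv i (Torus.partialDeriv j (Torus.partialDeriv k (θ s'))) x| ≤ M) →
      ∀ δ : ℝ, 0 < δ → ∃ C : ℝ, 0 < C ∧ ∀ N : ℕ,
      localGibbsLaw σ (fun x => ρ s x * Real.exp (hsExcessFreeEnergy (ρ s x * σ ^ 3) +
      ρ s x * σ ^ 3 * deriv hsExcessFreeEnergy (ρ s x * σ ^ 3))) (u s) (θ s) N (Φ N)
      {z | ((N : ℝ) + 1)⁻¹ * ∑ i, Real.log (localGibbsProfile
      (fun x => ρ t x * Real.exp (hsExcessFreeEnergy (ρ t x * σ ^ 3) +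
      ρ t x * σ ^ 3 * deriv hsExcessFreeEnergy (ρ t x * σ ^ 3))) (u t) (θ t)
      ((Φ N).flow (t - s) z i)) <
      (∫ x, ρ t x * (Real.log (ρ t x * Real.exp (hsExcessFreeEnergy (ρ t x * σ ^ 3) +
      ρ t x * σ ^ 3 * deriv hsExcessFreeEnergy (ρ t x * σ ^ 3))) -
      3 / 2 * Real.log (2 * Real.pi * θ t x) - 3 / 2)) - δ} ≤
      ENNReal.ofReal (C * Real.exp (-(C⁻¹ * (N + 1))))) :
    RestartPrinciple :=
  fun _ => guardedConjunct_of_noAnomalousDissipation hNAD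

end Summit.AtomisticToContinuum.HydrodynamicLimit.Theorems.RestartPrinciple.IsentropicRegibbsification

end
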